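/-
Copyright (c) 2026 the pub-hodgecm-mathlib formalisation cell (harness21).  Prover seat hodgecm-mathlib-R90-C133-p01 (g2), Track B ∕ K2-LIT ∕ R90-TF section S5
(Rogawski Ch. 13.3); census (H5) `CENSUS-1336cArch` §5 (deal R90-C133-plan (g2) 2026-09-05T01:01:56Z): the TRIGGER-AGNOSTIC core of ★ p862215's membership engine.
-/
import Summits.HodgeConjecture.HodgeConjecture.Theorems.R90S5FinTriggerMembershipOfCoreLawsAndPins   -- ★ p862215 (R90-C133-p01 (g0)) `finTriggerMembershipAt_of_coreLaws_of_pins`; brings ★ p862132 `mem_aPacket_of_m_ne_zero_of_coreLaws`, ★ `nComponent_routesToAPacket_of_coreLaws`, ★ Literature `TwistedComparisonData` + laws, ★ `MemXiFamily`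
import HarnessLib

/-!
# R90-TF · S5 — `R90S5TriggerMembershipCore`: the TRIGGER-AGNOSTIC CORE of the 13.3.6 (c) membership engine (★ p862215 ∕ ★ p861554) — «an n-COMPONENT routes a
# discrete class into an A-packet `Π(ξ′)`», the finite trigger (D ED. 4′) and the ARCHIMEDEAN `[J^δ]`-trigger at `ι` (A ED. 4 ∕ CENSUS-1336cArch) being two PINS of this one core

Cell `hodgecm-mathlib`, crux H413 (`stmt-HodgeConjecture-24833`), route of record `HCCMUnconditional`; programme R90-TF, section S5 (Rogawski Ch. 13.3); census (H5)
`R90/R90-C133-p01/g2/CENSUS-1336cArch.md` 0ba1242b7322346c §4 (V1) ∕ §5, hand R90-C133-p01 (g2).  PROOF lane (theorems only; no `def`, no instance, no notation, no named fact,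
no `sorry`); `--supports stmt-HodgeConjecture-24833 --as helper`; L9: NO `Lines` import.

WHY.  ★ p862215 `finTriggerMembershipAt_of_coreLaws_of_pins` proves «a `πⁿ(ξ_v) ∘ e` constituent at a FINITE non-split `v` routes the discrete `P` into SOME ξ′-envelope
★ `MemXiFamily`» from twelve NAMED laws of a ★ `TwistedComparisonData 𝔨` and named pins.  READ OFF ITS PROOF TERM (census §2): every law, the three discharged relations and the
pins `hPin_m ∕ hPin_mGp ∕ hPin_germGp` are PLACE-GENERIC — they speak `𝔨.HasNComponent : RepGp → Prop` («`π′` has a `πⁿ(ξ_v)`-component at some `v ∉ S₀`; for `v = ι`,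
`π′_ι = J^±_φ = πⁿ(ξ^±_ι)`», ★ `TwistedComparisonSpectralSide` :148–:150), `germGp`, `germRep`, never a place; the ONLY finite-specific input is the ANTECEDENT of the trigger
pin `hPin_n`.  This file cuts the core at `hN : 𝔨.HasNComponent clsGp`:
* §1 **`exists_aPacket_mem_of_hasNComponent_of_coreLaws`** — DICTIONARY-GENERIC, KIT-LEVEL conclusion `∃ Pk ξH, IsAPacket Pk ∧ IsOneDimH ξH ∧ liftsTo ξH Pk ∧ mem cls Pk`
  (no `L`, no `H`, no envelope pin) = print's «if `πⁿ(ξ_v)` occurs as a local component of a discrete `π`, then `π` occurs in line (3) of 13.7» + Thm. 13.3.7 on that line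
  [§13.10 p. 230–231] — what ★ p863841's row `h1336cArch` reads at the record (CENSUS §4 (V2));
* §2 **`memXiFamily_of_hasNComponent_of_coreLaws_of_pins`** — the ENVELOPE conclusion `∃ ξ′, MemXiFamily P … ξ′` through ★ p862215's pin `hPin_memEnv` (token for token);
  ★ p862215 = this ∘ its finite pin `hPin_n` (`finTriggerMembershipAt_eq_core`, an `example`-grade one-liner kept as a theorem-free remark in the docstring to avoid a duplicate);
* THE ARCHIMEDEAN TRIGGER (n∞) (A ED. 4 ∕ D ED. 5, where S5-A's frame and its `LieRing.ofAssociativeRing` local instance live): with A's binders `htok` (a non-zero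
  `(𝔤, K)`-map from ★ `P.archModuleCM ι T hT` to a coh-unitary irreducible `M`) and `hcls : GKIrrClass.ofModule M … = archDegOneClass δ hδ` and ONE new pin
  `hPin_nArch : ‹htok› → ‹hcls› → 𝔨.HasNComponent clsGp` (record discharge: S10-F's reading of `𝔗.HasNComponent`, JQ-S5→S10-9), the payer is the ONE-LINER
  `memXiFamily_of_hasNComponent_of_coreLaws_of_pins … (hPin_nArch htok hcls) hPin_memEnv` (kernel-checked here in a scratch, `R90/R90-C133-p01/g2/R90S5TriggerMembershipCore.lean`
  v1 7ed8f41e5ec6d4a1 §3, not shipped: the statement needs the Lines-side local Lie-bracket instance).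
HONEST LABEL: closes no socket; proves print's deduction from the named laws (each junk-satisfiable alone, ★ cert `CertJunkTwistedComparison`); the content enters at S10-F's
datum with its section sockets; REL ≠ ★ ≠ BUILT; HC_CM is proved only modulo the 7 printed citations (2 remaining named inputs: hLiu418 = stmt-HodgeConjecture-24832, h413 =
stmt-HodgeConjecture-24833) until rung 0 closes.

## References
* [Rogawski1990] J. D. Rogawski, *Automorphic Representations of Unitary Groups in Three Variables*, Ann. of Math. Stud. 123 (1990), Thm. 13.3.6 (c) p. 202; §13.10 pp. 230–231;
  Thm. 13.3.7 pp. 202–203; §13.7 p. 213; §14.6 p. 242, Prop. 14.6.2, Thm. 14.6.5; §12.3 Prop. 12.3.3 p. 178; §15.3 ¶1 p. 249.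
-/

set_option autoImplicit false
set_option linter.dupNamespace false -- the mandated namespace repeats `HodgeConjecture.HodgeConjecture`, as in every sibling `R90S5*` file

noncomputable section

open NumberField IsDedekindDomain MeasureTheory
open scoped Matrix ComplexOrder

open Literature.NumberTheory Literature.NumberTheory.Automorphic Literature.NumberTheory.Automorphic.UnitaryGroup
open Literature.NumberTheory.GaloisRepresentations
open Literature.NumberTheory.Rogawski1990
open Summit.HodgeConjecture.HodgeConjecture.Cruxes.H413

namespace Summit.HodgeConjecture.HodgeConjecture.R90.S5

/-! ## §1 The dictionary-generic, kit-level core [§13.10 pp. 230–231; Thm. 13.3.7] -/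

/-- **AN n-COMPONENT ROUTES A DISCRETE CLASS INTO AN A-PACKET — KIT LEVEL, DICTIONARY-GENERIC.**  For a ★ `TwistedComparisonData 𝔨` satisfying the SEVEN Thm-13.3.7 laws
(`MainEquality` [Thm. 10.3.1 (a)], `MatchTensor` [§4.5], `GermExpansion` [13.5.1, 13.6.1–2], `Separation` [§13.7], `CoeffEndoscopic` [13.7 (3) + L. 13.6.3], `APacketLift`
[13.2.2 (d)], `LinIndepGerm` [13.8.1]), the FIVE routing laws (`PacketTrichotomy` [Thm. 13.3.5], `PacketGerm` [§13.3 p. 201], `EvpDichotomyGp` [§14.6 ¶2], `StableExclusionGp`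
[Prop. 14.6.2 ∕ §13.10 p. 230], `EndoscopicExclusionGp` [Thm. 14.6.5 + 13.3.2 ∕ §12.3]), `OneDimNotTheta` [Prop. 11.1.1 (a)], and the pins `cls ∕ hPin_m ∕ clsGp ∕ hPin_mGp ∕
hPin_germGp` of ★ p862215 (token for token): IF `clsGp` HAS AN n-COMPONENT (`𝔨.HasNComponent clsGp` — at a finite non-split `v` OR at `ι`, the datum's reading) THEN `cls`
is a MEMBER of an A-packet `Pk = Π(ξH)` lifting a ONE-DIMENSIONAL `ξH`.  Proof = ★ `nComponent_routesToAPacket_of_coreLaws` (lines (2)∕(4) of 13.7 excluded ⇒ line (3)) +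
★ `mem_aPacket_of_m_ne_zero_of_coreLaws` (Thm. 13.3.7 on line (3): `m(cls) ≠ 0` in the germ of `Π(ξH)` ⇒ membership).  No place is mentioned.
[cite: Rogawski1990, §13.10 pp. 230–231; Thm. 13.3.6 (c) p. 202; Thm. 13.3.7 pp. 202–203; §14.6 p. 242] -/
theorem exists_aPacket_mem_of_hasNComponent_of_coreLaws {TGt TG TH : Type} (𝔨 : TwistedComparisonData TGt TG TH)
    (h0 : 𝔨.MainEquality) (hT : 𝔨.MatchTensor) (hE : 𝔨.GermExpansion) (hS : 𝔨.Separation) (hCE : 𝔨.CoeffEndoscopic)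
    (hAL : 𝔨.APacketLift) (hLI : 𝔨.LinIndepGerm)
    (hTri : 𝔨.𝔊.PacketTrichotomy) (hPG : 𝔨.PacketGerm) (hED : 𝔨.EvpDichotomyGp) (hSX : 𝔨.StableExclusionGp) (hEX : 𝔨.EndoscopicExclusionGp)
    (h1 : 𝔨.𝔊.OneDimNotTheta 𝔨.IsOneDimH)
    (cls : 𝔨.𝔊.Rep) (hPin_m : 𝔨.𝔊.m cls ≠ 0)
    (clsGp : 𝔨.RepGp) (hPin_mGp : 𝔨.mGp clsGp ≠ 0) (hPin_germGp : 𝔨.germRep cls = 𝔨.germGp clsGp)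
    (hN : 𝔨.HasNComponent clsGp) :
    ∃ (Pk : 𝔨.𝔊.Packet) (ξH : 𝔨.𝔊.PacketH), 𝔨.𝔊.IsAPacket Pk ∧ 𝔨.IsOneDimH ξH ∧ 𝔨.𝔊.liftsTo ξH Pk ∧ 𝔨.𝔊.mem cls Pk := by
  -- §13.10 p. 230: the n-component routes `clsGp` to the germ of an A-packet `Π(ξH)`, `ξH` one-dimensional (five routing laws)
  obtain ⟨-, ξH, -, h1d, -, hgerm, -⟩ := nComponent_routesToAPacket_of_coreLaws 𝔨 hTri hPG hED hSX hEX clsGp hPin_mGp hN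
  -- Thm. 13.3.7 on line (3): in that germ, `m(cls) ≠ 0` forces membership in `Π(ξH)` (seven core laws)
  obtain ⟨Pk, hA, hL, hmemPk⟩ := mem_aPacket_of_m_ne_zero_of_coreLaws 𝔨 h0 hT hE hS hCE hAL hLI ξH h1d (h1 ξH h1d)
  exact ⟨Pk, ξH, hA, h1d, hL, hmemPk cls (hPin_germGp.trans hgerm) hPin_m⟩

/-! ## §2 The envelope conclusion through ★ p862215's pin `hPin_memEnv` [§15.3 ¶1; §13.10] -/

section Envelope

variable (L : Type) [Field L] [NumberField L] [IsCMField L] (H : Matrix (Fin 3) (Fin 3) L)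
  (hH : (H.map (cmConjRingHom L))ᵀ = H) (hHd : IsUnit H.det) (μω : HeckeCharacter L) (hμu : μω.IsUnitary)
  (μA : Measure (adelicGroupData (↥(maximalRealSubfield L)) L (IsCMField.complexConj L) 3 H).automorphicQuotient)
  [(adelicGroupData (↥(maximalRealSubfield L)) L (IsCMField.complexConj L) 3 H).IsAutomorphicMeasure μA]
  (P : DiscreteAutomorphicRep (adelicGroupData (↥(maximalRealSubfield L)) L (IsCMField.complexConj L) 3 H) μA)

/-- **THE TRIGGER-AGNOSTIC ENGINE, ENVELOPE FORM** (every inner form `U(H)`; quasi-split case `H := qsForm L`): ★ p862215's statement with its finite antecedent REPLACED by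
`hN : 𝔨.HasNComponent clsGp` — IF `clsGp` has an n-component THEN `P` lies in the ξ′-envelope ★ `MemXiFamily` of SOME one-dimensional `ξ′` (pin `hPin_memEnv` token for token:
kit membership in an A-packet lifting a one-dimensional `ξH` ⇒ envelope).  ★ p862215 is this theorem ∘ its pin `hPin_n` (same proof term).
[cite: Rogawski1990, Thm. 13.3.6 (c) p. 202; §13.10 pp. 230–231; §15.3 ¶1 p. 249] -/
theorem memXiFamily_of_hasNComponent_of_coreLaws_of_pins {TGt TG TH : Type} (𝔨 : TwistedComparisonData TGt TG TH)
    (h0 : 𝔨.MainEquality) (hT : 𝔨.MatchTensor) (hE : 𝔨.GermExpansion) (hS : 𝔨.Separation) (hCE : 𝔨.CoeffEndoscopic)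
    (hAL : 𝔨.APacketLift) (hLI : 𝔨.LinIndepGerm)
    (hTri : 𝔨.𝔊.PacketTrichotomy) (hPG : 𝔨.PacketGerm) (hED : 𝔨.EvpDichotomyGp) (hSX : 𝔨.StableExclusionGp) (hEX : 𝔨.EndoscopicExclusionGp)
    (h1 : 𝔨.𝔊.OneDimNotTheta 𝔨.IsOneDimH)
    (cls : 𝔨.𝔊.Rep) (hPin_m : 𝔨.𝔊.m cls ≠ 0)
    (clsGp : 𝔨.RepGp) (hPin_mGp : 𝔨.mGp clsGp ≠ 0) (hPin_germGp : 𝔨.germRep cls = 𝔨.germGp clsGp)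
    (hN : 𝔨.HasNComponent clsGp)
    (hPin_memEnv : ∀ (Pk : 𝔨.𝔊.Packet) (ξH : 𝔨.𝔊.PacketH), 𝔨.𝔊.IsAPacket Pk → 𝔨.IsOneDimH ξH → 𝔨.𝔊.liftsTo ξH Pk → 𝔨.𝔊.mem cls Pk →
      ∃ ξ' : OneDimAutRepH L, MemXiFamily P hH hHd μω hμu ξ') :
    ∃ ξ' : OneDimAutRepH L, MemXiFamily P hH hHd μω hμu ξ' := by
  obtain ⟨Pk, ξH, hA, h1d, hL, hmem⟩ :=
    exists_aPacket_mem_of_hasNComponent_of_coreLaws 𝔨 h0 hT hE hS hCE hAL hLI hTri hPG hED hSX hEX h1 cls hPin_m clsGp hPin_mGp hPin_germGp hN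
  exact hPin_memEnv Pk ξH hA h1d hL hmem

/- JUNCTION BY TYPE (in-file, zero tree bytes elsewhere): ★ p862215 `finTriggerMembershipAt_of_coreLaws_of_pins` IS the envelope core ∘ its finite pin `hPin_n`. -/
example : type_of% @finTriggerMembershipAt_of_coreLaws_of_pins := by
  intro L _ _ _ H hH hHd μω hμu μA _ P v T a ha h πn TGt TG TH 𝔨 h0 hT hE hS hCE hAL hLI hTri hPG hED hSX hEX h1 cls hPin_m clsGp hPin_mGp
    hPin_germGp hPin_n hPin_memEnv htrig
  exact memXiFamily_of_hasNComponent_of_coreLaws_of_pins L H hH hHd μω hμu μA P 𝔨 h0 hT hE hS hCE hAL hLI hTri hPG hED hSX hEX h1 cls hPin_m clsGp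
    hPin_mGp hPin_germGp (hPin_n htrig) hPin_memEnv

end Envelope

end Summit.HodgeConjecture.HodgeConjecture.R90.S5

end
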